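import Summits.Schanuel.Schanuel.Theorems.RootDecomp1EUnsaturatedCore03

/-!
# RootDecomp1E · round 13 (lens-2 «structural dichotomy», gen 13) — UNSATURATED CORE, part 4 of 4

Continuation of `RootDecomp1EUnsaturatedCore03`.  This part: §6 second half: the named statement `ELogPlane` and its arrows (from PlainDefectOne / DefectOneSchanuel / AlgIndepLogarithms / ExpOnePiAlgebraicIndependent; instances log 2, log 3), §7 the deciding theorems `closes`, `closes_twoCell` through the live route.  Source: lens-2 g13 `UnsaturatedCore.lean`
(sha256 0f7762d0…) lines 813–978 verbatim (namespace renamed `…Theses.UnsaturatedCore` →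
`…Theorems.RootDecomp1EUnsaturatedCore` for the Theorems tree); port `--supports stmt-Schanuel-25020`
(critic g6 cleared LOW).  Sorry-free; standard axioms; nothing here proves Schanuel (rung 0).
-/

noncomputable section

namespace Summit.Schanuel.Schanuel.Theorems.RootDecomp1EUnsaturatedCore

open Complex IntermediateField
open Summit.Schanuel.Schanuel.Theses.RootDecomp1E (DefectOneSchanuel SaturatedSchanuel PlainDefectOne
  ClosedFormAtomSchanuel AlgAnchoredDarkAtomSchanuel LineLogDarkAtomSchanuel DeepLogDarkAtomSchanuel
  OffAxisClosure FreeDarkAtomSchanuel)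
open Summit.Schanuel.Schanuel.Theorems.RootDecomp1EAnchor (isAlgebraic_of_mem_adjoin trdeg_adjoin_le_of_isAlgebraic
  trdeg_le_of_mem_span trdeg_eq_of_span_eq isAlgebraic_of_trdeg_sandwich gens_cons_isAlgebraic Saturated)
open Summit.Schanuel.Schanuel.Theorems.RootDecomp1EEngineType (trdeg_eq_nat two_le_trdeg_of_algebraicIndependent
  algebraicIndependent_pi_exp_pi)
open Summit.Schanuel.Schanuel.Theorems.RootDecomp1EModuleGrids (subMinimal_three rat_mul_pi_eq_rat
  rat_log_two_log_three_indep)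
open Summit.Schanuel.Schanuel.Theorems.RootDecomp1EModuleType (SubMinimalDefect)
open Summit.Schanuel.Schanuel.Theorems.RootDecomp1ELevels (le_trdeg_of_algebraicIndependent)
open Literature.NumberTheory.Transcendental (transcendental_exp_holds nesterenko exists_nsmul_mem_span_int
  ExpOneAddPiIrrational ExpOnePiAlgebraicIndependent)
open Literature.Barriers.Schanuel (AlgIndepLogarithms algIndepLogarithms_of_schanuel linearIndependent_piI_log_two
  algebraicIndependent_piI_log_two_of_algIndepLogarithms gridField₂ smallTrdeg_thm_2_9_two_two)

/-- piece:named-substatement · **`ELogPlane`** — «for all ℚ-linearly independent logarithms `ℓ₁, ℓ₂` of algebraic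
numbers, at least two of `e, ℓ₁, ℓ₂` are algebraically independent». `PlainDefectOne` (31410) on the log-plane
family is exactly this; the 2-variable case of `AlgIndepLogarithms` implies it. Open (instances: two of
`e, π, log 2`; two of `e, log 2, log 3`). Not a registry item: a NAME for the decoded family demand. -/
def ELogPlane : Prop :=
  ∀ ℓ₁ ℓ₂ : ℂ, LinearIndependent ℚ ![ℓ₁, ℓ₂] → IsAlgebraic ℚ (cexp ℓ₁) → IsAlgebraic ℚ (cexp ℓ₂) →
    (2 : Cardinal) ≤ Algebra.trdeg ℚ ↥(adjoin ℚ ({cexp 1, ℓ₁, ℓ₂} : Set ℂ))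

/-- piece:proved · **PLAIN 31410 ⟹ `ELogPlane`** (its restriction to the certified log-plane family). -/
theorem eLogPlane_of_plainDefectOne (hP : PlainDefectOne) : ELogPlane := fun _ _ hLI h₁ h₂ =>
  (plainDemand_logPlaneTriple_iff h₁ h₂).1
    (hP 3 _ (logPlaneTriple_linearIndependent hLI h₁ h₂) (logPlaneTriple_multiplier_rational h₁ h₂)
      (subMinimal_three _))

/-- piece:proved · `S⁻` (stmt-25020) ⟹ `ELogPlane` as well (each `(1, ℓ₁, ℓ₂)` is a genuine `S⁻₃` instance). -/
theorem eLogPlane_of_defectOne (hD : DefectOneSchanuel) : ELogPlane := fun _ _ hLI h₁ h₂ =>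
  (plainDemand_logPlaneTriple_iff h₁ h₂).1 (hD 3 _ (logPlaneTriple_linearIndependent hLI h₁ h₂))

/-- piece:reduction(c″) · **`AlgIndepLogarithms` (2 variables) ⟹ `ELogPlane`**: it makes `ℓ₁, ℓ₂` themselves
algebraically independent. -/
theorem eLogPlane_of_algIndepLogarithms (h : AlgIndepLogarithms) : ELogPlane := by
  intro ℓ₁ ℓ₂ hLI h₁ h₂
  have hai : AlgebraicIndependent ℚ ![ℓ₁, ℓ₂] := by
    refine h 2 _ ?_ hLI
    intro i
    fin_cases i
    · simpa using h₁
    · simpa using h₂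
  refine two_le_trdeg_of_algebraicIndependent hai ?_
  intro i
  fin_cases i
  · exact subset_adjoin ℚ _ (by simp)
  · exact subset_adjoin ℚ _ (by simp)

/-- `M₁`'s demand is the instance `(ℓ₁, ℓ₂) = (iπ, log 2)` of `ELogPlane`. -/
theorem logTwoTriple_demand_of_eLogPlane (h : ELogPlane) :
    ((3 : ℕ) : Cardinal) ≤
      Algebra.trdeg ℚ ↥(adjoin ℚ (Set.range logTwoTriple ∪ Set.range (cexp ∘ logTwoTriple))) + 1 := by
  have hexp2 : cexp (Real.log 2 : ℂ) = 2 := by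
    rw [← Complex.ofReal_exp, Real.exp_log two_pos]
    norm_num
  rw [logTwoTriple_demand_iff]
  refine h _ _ linearIndependent_piI_log_two ?_ ?_
  · rw [Complex.exp_pi_mul_I]
    exact_mod_cast isAlgebraic_int (R := ℚ) (A := ℂ) (-1)
  · rw [hexp2]
    exact_mod_cast isAlgebraic_nat (R := ℚ) (A := ℂ) 2

/-- `(log 2, log 3)` is ℚ-free (`2^a 3^b = 1 ⟹ a = b = 0`, tree lemma `rat_log_two_log_three_indep`). -/
private theorem linearIndependent_log_two_log_three :
    LinearIndependent ℚ ![(Real.log 2 : ℂ), (Real.log 3 : ℂ)] := by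
  rw [LinearIndependent.pair_iff]
  intro s t hst
  rw [Rat.smul_def, Rat.smul_def] at hst
  have hre := congrArg Complex.re hst
  simp only [Complex.add_re, Complex.mul_re, Complex.ratCast_re, Complex.ratCast_im, Complex.ofReal_re,
    Complex.ofReal_im, mul_zero, sub_zero, Complex.zero_re] at hre
  exact rat_log_two_log_three_indep hre

/-- piece:member(b″) · **`M₂ = (1, log 2, log 3)`**: the second certified member; its demand is «two of
`e, log 2, log 3` are algebraically independent» (OPEN; decided by `ELogPlane`, hence by `AlgIndepLogarithms`). -/
theorem logThreeTriple_demand_of_eLogPlane (h : ELogPlane) :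
    (2 : Cardinal) ≤ Algebra.trdeg ℚ ↥(adjoin ℚ ({cexp 1, (Real.log 2 : ℂ), (Real.log 3 : ℂ)} : Set ℂ)) := by
  have hexp2 : cexp (Real.log 2 : ℂ) = 2 := by
    rw [← Complex.ofReal_exp, Real.exp_log two_pos]
    norm_num
  have hexp3 : cexp (Real.log 3 : ℂ) = 3 := by
    rw [← Complex.ofReal_exp, Real.exp_log (by norm_num : (0 : ℝ) < 3)]
    norm_num
  refine h _ _ linearIndependent_log_two_log_three ?_ ?_
  · rw [hexp2]
    exact_mod_cast isAlgebraic_nat (R := ℚ) (A := ℂ) 2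
  · rw [hexp3]
    exact_mod_cast isAlgebraic_nat (R := ℚ) (A := ℂ) 3

/-- … and `M₂` is a member of 31410's hypothesis class by THEOREM B. -/
theorem logThreeTriple_mem_plainClass :
    LinearIndependent ℚ ![(1 : ℂ), (Real.log 2 : ℂ), (Real.log 3 : ℂ)] ∧
      (∀ β : ℂ, IsAlgebraic ℚ β →
        (∀ i, β * (![(1 : ℂ), (Real.log 2 : ℂ), (Real.log 3 : ℂ)]) i ∈
            Submodule.span ℚ (Set.range ![(1 : ℂ), (Real.log 2 : ℂ), (Real.log 3 : ℂ)])) →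
          β ∈ Set.range (algebraMap ℚ ℂ)) ∧
      SubMinimalDefect 3 ![(1 : ℂ), (Real.log 2 : ℂ), (Real.log 3 : ℂ)] := by
  have hexp2 : cexp (Real.log 2 : ℂ) = 2 := by
    rw [← Complex.ofReal_exp, Real.exp_log two_pos]
    norm_num
  have hexp3 : cexp (Real.log 3 : ℂ) = 3 := by
    rw [← Complex.ofReal_exp, Real.exp_log (by norm_num : (0 : ℝ) < 3)]
    norm_num
  refine logPlaneTriple_mem_plainClass linearIndependent_log_two_log_three ?_ ?_
  · rw [hexp2]
    exact_mod_cast isAlgebraic_nat (R := ℚ) (A := ℂ) 2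
  · rw [hexp3]
    exact_mod_cast isAlgebraic_nat (R := ℚ) (A := ℂ) 3

/-- piece:wall · the `e`-side of `G`, stated against the REGISTERED open statement
`Literature.NumberTheory.Transcendental.ExpOneAddPiIrrational` (periods.S15, «`e + π` is irrational», open in
print): certifying `e ∉ ℚ(π)^alg` — let alone `e ∉ ℚ(π, e^π)^alg`, the `e`-half of `G` — would settle it. -/
theorem expOneAddPiIrrational_of_not_mem (h : cexp 1 ∉ adjoin ℚ ({(Real.pi : ℂ)} : Set ℂ)) :
    ExpOneAddPiIrrational := by
  unfold ExpOneAddPiIrrational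
  exact irrational_exp_one_add_pi_of_not_mem h

/-- piece:reduction(c″) · the REGISTERED open statement `ExpOnePiAlgebraicIndependent` (periods.S15, «`e` and `π`
are algebraically independent»; a consequence of Schanuel, open in print) ALSO decides `M₁`'s demand — two named
printed conjectures below `S` (`AlgIndepLogarithms`, `ExpOnePiAlgebraicIndependent`), from opposite sides
(`𝓛`-side / `e`-side), each settle the member. -/
theorem logTwoTriple_demand_of_expOnePiAlgebraicIndependent (h : ExpOnePiAlgebraicIndependent) :
    ((3 : ℕ) : Cardinal) ≤
      Algebra.trdeg ℚ ↥(adjoin ℚ (Set.range logTwoTriple ∪ Set.range (cexp ∘ logTwoTriple))) + 1 := by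
  rw [logTwoTriple_demand_iff]
  have h2 : AlgebraicIndependent ℚ ![cexp 1, (Real.pi : ℂ)] := by
    have e : (![cexp 1, (Real.pi : ℂ)] : Fin 2 → ℂ) =
        (Complex.ofRealAm.restrictScalars ℚ) ∘ ![Real.exp 1, Real.pi] := by
      funext i; fin_cases i <;> simp [Complex.ofReal_exp]
    rw [e]
    have h' : AlgebraicIndependent ℚ ![Real.exp 1, Real.pi] := by
      unfold ExpOnePiAlgebraicIndependent at h
      exact h
    exact h'.map' Complex.ofReal_injective
  have hI : IsAlgebraic ℚ I := by
    refine IsAlgebraic.of_pow (n := 2) two_pos ?_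
    rw [Complex.I_sq]
    exact_mod_cast isAlgebraic_int (R := ℚ) (A := ℂ) (-1)
  have hLL' : Algebra.trdeg ℚ ↥(adjoin ℚ ({cexp 1, (Real.pi : ℂ) * I, (Real.log 2 : ℂ), I} : Set ℂ)) ≤
      Algebra.trdeg ℚ ↥(adjoin ℚ ({cexp 1, (Real.pi : ℂ) * I, (Real.log 2 : ℂ)} : Set ℂ)) := by
    refine trdeg_adjoin_le_of_isAlgebraic ?_
    intro x hx
    simp only [Set.mem_insert_iff, Set.mem_singleton_iff] at hx
    rcases hx with rfl | rfl | rfl | rfl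
    · exact isAlgebraic_of_mem_adjoin (subset_adjoin ℚ _ (by simp))
    · exact isAlgebraic_of_mem_adjoin (subset_adjoin ℚ _ (by simp))
    · exact isAlgebraic_of_mem_adjoin (subset_adjoin ℚ _ (by simp))
    · exact hI.tower_top _
  refine le_trans ?_ hLL'
  refine two_le_trdeg_of_algebraicIndependent h2 ?_
  intro i
  fin_cases i
  · exact subset_adjoin ℚ _ (by simp)
  · show (Real.pi : ℂ) ∈ adjoin ℚ ({cexp 1, (Real.pi : ℂ) * I, (Real.log 2 : ℂ), I} : Set ℂ)
    have hπI : (Real.pi : ℂ) * I ∈ adjoin ℚ ({cexp 1, (Real.pi : ℂ) * I, (Real.log 2 : ℂ), I} : Set ℂ) :=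
      subset_adjoin ℚ _ (by simp)
    have hIm : I ∈ adjoin ℚ ({cexp 1, (Real.pi : ℂ) * I, (Real.log 2 : ℂ), I} : Set ℂ) :=
      subset_adjoin ℚ _ (by simp)
    have hπ : (Real.pi : ℂ) = ((Real.pi : ℂ) * I) * (-I) := by
      rw [mul_assoc, mul_neg, Complex.I_mul_I, neg_neg, mul_one]
    have key : ((Real.pi : ℂ) * I) * (-I) ∈ adjoin ℚ ({cexp 1, (Real.pi : ℂ) * I, (Real.log 2 : ℂ), I} : Set ℂ) :=
      mul_mem hπI (neg_mem hIm)
    rwa [← hπ] at key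

/-! ## §7 The deciding theorem through the live route -/

/-- piece:closes · `Schanuel ⟸ UnsaturatedSchanuel ∧ CF ∧ AADK ∧ LLDK ∧ DLDK ∧ OffAxis ∧ FDK`, by the LIVE
`RootDecomp1E.closes` with `hD := defectOne_of_unsaturatedSchanuel hU` (THEOREM A). -/
theorem closes (hU : UnsaturatedSchanuel) (hC : ClosedFormAtomSchanuel) (hAlg : AlgAnchoredDarkAtomSchanuel)
    (hLine : LineLogDarkAtomSchanuel) (hDeep : DeepLogDarkAtomSchanuel) (hOff : OffAxisClosure)
    (hF : FreeDarkAtomSchanuel) : _root_.Schanuel :=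
  Summit.Schanuel.Schanuel.Theses.RootDecomp1E.closes (defectOne_of_unsaturatedSchanuel hU) hC hAlg hLine
    hDeep hOff hF

/-- The two-cell form of the same decision: `Schanuel ⟸ UnsaturatedSchanuel ∧ SaturatedSchanuel` (exact). -/
theorem closes_twoCell (hU : UnsaturatedSchanuel) (hSat : SaturatedSchanuel) : _root_.Schanuel :=
  schanuel_iff_unsaturated_and_saturated.2 ⟨hU, hSat⟩

end Summit.Schanuel.Schanuel.Theorems.RootDecomp1EUnsaturatedCore
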